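import Summits.NavierStokesRegularity.NavierStokesRegularity.Theses.SymmetryModuliCount
import Literature.Analysis.FluidPDE.TypeIAncientMild
import Literature.Analysis.FluidPDE.OseenKernelSemigroup
import Literature.Analysis.UnboundedOperators.HeatLiouville
import Summits.NavierStokesRegularity.NavierStokesRegularity.Theorems.SqueezeCycleExtremalBiaxialitySubcriticalSmallConstant

/-!
# Crux `HelicalEndLiouville` (stmt-NavierStokesRegularity-14062) — ideator 3, round 1: first lemmas (v3, gen-2 pass 2026-08-16: card 2 sharpened to the STABILITY form, §"Card 2, v2" below)

Card `wirtinger-gap-far-past-collapse` ("the non-axial Fourier modes of a periodic Type-I ancient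
mild solution are slaved to zero on a backward end"). Everything below is a STATEMENT over existing
tree declarations (`IsTypeIAncientMild`, `oseenKernel`, `UnboundedOperators.heatExtension`) plus the
kernel-checked glue showing that the three statements of the line conclude the crux BY NAME.
No proof obligations of the line are discharged here (ideate stage: no skeleton).
-/

noncomputable section

open MeasureTheory Set Function Filter
open scoped RealInnerProductSpace

namespace Summit.NavierStokesRegularity.NavierStokesRegularity.Cruxes.HelicalEndLiouville.Ideator3

open Literature.Analysis.FluidPDE

local notation "E3" => EuclideanSpace ℝ (Fin 3)

/-! ## The screw calculus (shared with every line; Cruxes/ForcedSymmetry Ideator2Sketch) -/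

/-- **Helical-or-translation ⇒ lattice** (S): a Killing generator `(a, A)`, `A` skew, `a ∉ range A`,
annihilating `u` on the end `t < θ` makes `u(t, ·)` periodic there with a nonzero period vector
`L = (2π/ρ)·P_{ker A} a` (one full turn of the screw; `L = a` if `A = 0`). -/
def HelicalOrTranslationIsPeriodic : Prop :=
  ∀ (C : ℝ) (u : ℝ → E3 → E3), IsTypeIAncientMild C u →
    ∀ (a : E3) (A : E3 →L[ℝ] E3) (θ : ℝ), (∀ x, ⟪A x, x⟫ = 0) → a ∉ Set.range A → θ ≤ 0 →
      (∀ t < θ, ∀ x, fderiv ℝ (u t) x (a + A x) - A (u t x) = 0) →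
        ∃ L : E3, L ≠ 0 ∧ ∀ t < θ, ∀ x, u t (x + L) = u t x

/-! ## The lever: Wirtinger gap ⇒ far-past collapse of the non-axial part -/

/-- **FIRST LEMMA (the line's target sub-statement; TRANSFER `C⁺`)** — *discrete ⇒ continuous
translation symmetry on a backward end*: an element of `A_C` which is `L`-periodic on `t < θ` is
invariant under ALL translations along `L` on `t < θ`. Mechanism: the vertical-mean-zero part
`ũ = u − ū` obeys the Volterra identity from `s = −∞`,
`ũ(t) = −∫_{−∞}^t e^{(t−τ)Δ}P∇·[ū⊗ũ + ũ⊗ū + Q(ũ⊗ũ)](τ) dτ`, whose kernel on vertically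
mean-zero inputs has FINITE MASS `∫₀^∞ min(c₀σ^{-1/2}, c₁‖L‖²σ^{-3/2}) dσ = c‖L‖` (Wirtinger gap,
`GappedOseenBound`) while the coefficient `‖ū(τ)‖ ≤ C/√(−τ)` tends to zero: the sup
`m(t) = sup_{τ≤t} ‖ũ(τ)‖_∞ ≤ 2C/√(−t)` satisfies `m(t) ≤ 6 c ‖L‖ C m(t)/√(−t)`, hence `m ≡ 0` for
`−t > (6c‖L‖C)²`, and forward stepping on short windows carries `ũ ≡ 0` up to `θ`. -/
def PeriodicEndCollapse : Prop :=
  ∀ (C : ℝ) (u : ℝ → E3 → E3), IsTypeIAncientMild C u → ∀ (L : E3) (θ : ℝ), θ ≤ 0 →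
    (∀ t < θ, ∀ x, u t (x + L) = u t x) → ∀ t < θ, ∀ (x : E3) (s : ℝ), u t (x + s • L) = u t x

/-- **The quantitative heart** (far-past form, with the period-Reynolds threshold displayed):
there is an absolute `κ > 0` such that an `L`-periodic (on `t < θ`) element of `A_C` is invariant
under all translations along `L` at every time `t < θ` with `−t > (κ C ‖L‖)²` — "in the far past
every periodic Type-I ancient flow is a thin-domain (low period-Reynolds-number `‖L‖C/√(−t)`) flow,
hence exactly 2.5-dimensional". `PeriodicEndCollapse` = this + forward stepping. -/
def PeriodicFarPastCollapse : Prop :=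
  ∃ κ : ℝ, 0 < κ ∧ ∀ (C : ℝ) (u : ℝ → E3 → E3), IsTypeIAncientMild C u → ∀ (L : E3) (θ : ℝ),
    θ ≤ 0 → (∀ t < θ, ∀ x, u t (x + L) = u t x) →
      ∀ t < θ, t < -((κ * C * ‖L‖) ^ 2) → ∀ (x : E3) (s : ℝ), u t (x + s • L) = u t x

/-- **First analytic stub (S–M): the `L^∞` Wirtinger gap for the heat flow.** A bounded measurable
field, `L`-periodic with zero means over every period segment, is the second directional
derivative along `L` of a bounded periodic field of size `‖L‖² ×` its own; integrating by parts
twice against the Gaussian (`‖∂²_L G_σ‖_{L¹} = c σ^{-1}`, tree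
`integral_norm_iteratedFDeriv_heatKernel_eq`) gives `‖e^{σΔ} G‖_∞ ≤ c ‖L‖² σ^{-1} ‖G‖_∞`. -/
def VerticalMeanZeroHeatDecay : Prop :=
  ∃ c : ℝ, ∀ (L : E3) (G : E3 → E3) (M : ℝ), Measurable G → (∀ x, ‖G x‖ ≤ M) →
    (∀ x, G (x + L) = G x) → (∀ x, ∫ s in (0 : ℝ)..1, G (x + s • L) = 0) →
      ∀ σ : ℝ, 0 < σ → ∀ x : E3,
        ‖Literature.Analysis.UnboundedOperators.heatExtension G σ x‖ ≤ c * ‖L‖ ^ 2 / σ * M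

/-- **Second analytic stub (M−): the gapped Oseen bound.** For a bounded measurable scalar weight
`g`, `L`-periodic with zero period means, the Oseen slice `∫ g(y) K(σ, x−y)[a, b] dy` is bounded by
`c · min(σ^{-1/2}, ‖L‖² σ^{-3/2}) · ‖g‖_∞ ‖a‖ ‖b‖` — the kernel bound (14) of the tree for small `σ`,
and for large `σ` the semigroup factorisation `K(σ) = e^{(σ/2)Δ} K(σ/2)` (tree
`heatExtension_oseenKernel`) followed by `VerticalMeanZeroHeatDecay`. Its time integral is the
finite mass `4c‖L‖` that closes the contraction. -/
def GappedOseenBound : Prop :=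
  ∃ c : ℝ, ∀ (L : E3) (g : E3 → ℝ) (M : ℝ), Measurable g → (∀ y, |g y| ≤ M) →
    (∀ y, g (y + L) = g y) → (∀ y, ∫ s in (0 : ℝ)..1, g (y + s • L) = 0) →
      ∀ σ : ℝ, 0 < σ → ∀ (a b x : E3),
        ‖∫ y, g y • oseenKernel σ (x - y) a b‖ ≤
          c * min (σ ^ (-(1 / 2 : ℝ))) (‖L‖ ^ 2 * σ ^ (-(3 / 2 : ℝ))) * M * ‖a‖ * ‖b‖

/-! ## The finish (shared with the translational leaf of every line) -/

/-- **Line-invariant end-Liouville** (S–M, a corollary of the PROVED tree theorem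
`KNSS2009_typeI_rate_liouville_holds` after a rotation taking `L` to `e₂` — rotation covariance of
the closed-form Oseen kernel, `K(σ, Rz)[Ra, Rb] = R K(σ, z)[a, b]` for a linear isometry `R`, read
off `oseenKernel`'s Gaussian-weight formula — and the backward time shift `u(· + θ')`, `θ' < θ`,
which makes the field bounded, tree `IsTypeIAncientMild.comp_sub_right`): an element of `A_C`
invariant under all translations along a nonzero `L` on `t < θ` vanishes there. -/
def LineInvariantEndLiouville : Prop :=
  ∀ (C : ℝ) (u : ℝ → E3 → E3), IsTypeIAncientMild C u → ∀ (L : E3) (θ : ℝ), L ≠ 0 → θ ≤ 0 →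
    (∀ t < θ, ∀ (x : E3) (s : ℝ), u t (x + s • L) = u t x) → ∀ t < θ, ∀ x, u t x = 0

/-! ## Card 2 (`interior-time-blow-down`, the route's recorded plan made concrete): first lemmas

The baseline lever — parabolic blow-down at far-past near-maximisers, compactness by the tree's
Lemma 6.1 toolkit, kill of the line-invariant limit at the INTERIOR time `−1`, Kato gap — typed over
existing declarations so that triage can compare it with the gap lever above. -/

/-- **Sequential compactness of `A_C` into the hypothesis class of `KNSS2009_typeI_rate_liouville`**
(M−; a re-run of steps 2–5 of the tree proof `KNSS2009_typeI_rate_compactness_of_oseenMild` with the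
mildness clause free: uniform `1/4`-Hölder modulus `exists_holder_quarter_of_oseenMild` on the slab
pieces, diagonal extraction `exists_strictMono_tendstoUniformlyOn_of_bound`, passage of the bound, of
weak divergence-freeness and of the Oseen identity `tendsto_heatExtension/oseenDuhamel_of_tendsto_of_bound`).
The limit need NOT be smooth: the tree Liouville theorem asks only for continuity. -/
def ACSequentialCompactness : Prop :=
  ∀ (C : ℝ) (v : ℕ → ℝ → E3 → E3), (∀ n, IsTypeIAncientMild C (v n)) →
    ∃ φ : ℕ → ℕ, StrictMono φ ∧ ∃ W : ℝ → E3 → E3,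
      ContinuousOn (uncurry W) (Iio 0 ×ˢ univ) ∧ (∀ t < 0, IsWeaklyDivFree (W t)) ∧
      (∀ s t : ℝ, s < t → t < 0 → ∀ x,
        W t x = Literature.Analysis.UnboundedOperators.heatExtension (W s) (t - s) x -
          oseenDuhamel 1 s W W t x) ∧
      (∀ t < 0, ∀ x, Real.sqrt (-t) * ‖W t x‖ ≤ C) ∧
      (∀ t < 0, ∀ x, Tendsto (fun n => v (φ n) t x) atTop (nhds (W t x))) ∧
      -- equi-Hölder in space on every window (the symmetry-upgrade input: periods `ℓₙ → 0` of the
      -- `v (φ n)` become invariance of `W` under ALL translations along the period direction)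
      (∀ δ : ℝ, 0 < δ → ∃ K : ℝ, ∀ n, ∀ t ∈ Icc (-δ⁻¹) (-δ), ∀ x x' : E3,
        ‖v n t x' - v n t x‖ ≤ K * ‖x' - x‖ ^ (1 / 4 : ℝ))

/-- **Backward amplitude of a periodic element is zero** (M: blow-down `λₙ u(λₙ² s, xₙ + λₙ y)`,
`λₙ = √(−tₙ)`, at near-maximisers of `√(−t)‖u(t)‖_∞` with `tₙ → −∞`; `ACSequentialCompactness`;
the limit is invariant along the period direction (periods `‖L‖/λₙ → 0` + equi-Hölder), nonzero at
the interior point `(−1, 0)`, bounded after a shift, and is killed by `LineInvariantEndLiouville` /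
`KNSS2009_typeI_rate_liouville_holds` — contradiction). -/
def PeriodicBackwardAmplitudeZero : Prop :=
  ∀ (C : ℝ) (u : ℝ → E3 → E3), IsTypeIAncientMild C u → ∀ (L : E3) (θ : ℝ), L ≠ 0 → θ ≤ 0 →
    (∀ t < θ, ∀ x, u t (x + L) = u t x) →
      ∀ ε : ℝ, 0 < ε → ∃ T : ℝ, 0 < T ∧ ∀ t < -T, ∀ x, Real.sqrt (-t) * ‖u t x‖ ≤ ε

/-- **Kato gap at `t = −∞` plus forward stepping** (S–M): an element of `A_C` whose backward
amplitude `√(−t)‖u(t)‖_∞` tends to `0` as `t → −∞` vanishes identically — flush the mild identity to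
`s = −∞` (`u(t) = −B_{−∞}(u,u)(t)`), bound `√(−t)‖u(t)‖_∞ ≤ πc·(sup_{τ≤t}√(−τ)‖u(τ)‖_∞)²` using
`∫_{−∞}^t (t−τ)^{-1/2}(−τ)^{-1}dτ = π/√(−t)`, so the running sup `f` obeys `f ≤ πc f²` and, being
`< 1/(πc)` far back, vanishes on a far end; restart on short windows up to `0`. -/
def KatoGapFromMinusInfinity : Prop :=
  ∀ (C : ℝ) (u : ℝ → E3 → E3), IsTypeIAncientMild C u →
    (∀ ε : ℝ, 0 < ε → ∃ T : ℝ, 0 < T ∧ ∀ t < -T, ∀ x, Real.sqrt (-t) * ‖u t x‖ ≤ ε) →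
      ∀ t < 0, ∀ x, u t x = 0

/-- Glue of card 2 (pure logic): periodic ⇒ amplitude zero ⇒ Kato ⇒ `u ≡ 0` on all of `t < 0`, in
particular on the end; with the screw calculus this is the crux. -/
theorem periodicEndLiouville_of_blowDown (hA : PeriodicBackwardAmplitudeZero)
    (hK : KatoGapFromMinusInfinity) :
    ∀ (C : ℝ) (u : ℝ → E3 → E3), IsTypeIAncientMild C u → ∀ (L : E3) (θ : ℝ), L ≠ 0 → θ ≤ 0 →
      (∀ t < θ, ∀ x, u t (x + L) = u t x) → ∀ t < θ, ∀ x, u t x = 0 := by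
  intro C u hu L θ hL hθ hper t ht x
  exact hK C u hu (hA C u hu L θ hL hθ hper) t (lt_of_lt_of_le ht hθ) x

/-! ## Glue: the three statements conclude the crux (kernel-checked, no sorry)

The farm's copy of the route module may predate rev 5 (refuter note on the item: "stale farm route
module"), so the crux is restated here VERBATIM (signature of stmt-NavierStokesRegularity-14062, from
`ledger workitem get`) as `HelicalEndLiouvilleVerbatim`, and the glue is proved against it. -/

/-- VERBATIM copy of the route decl `Theses.SymmetryModuliCount.HelicalEndLiouville`
(stmt-NavierStokesRegularity-14062; identical signature). -/
def HelicalEndLiouvilleVerbatim : Prop :=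
  ∀ (C : ℝ) (u : ℝ → EuclideanSpace ℝ (Fin 3) → EuclideanSpace ℝ (Fin 3)), Literature.Analysis.FluidPDE.IsTypeIAncientMild C u → ∀ (a : EuclideanSpace ℝ (Fin 3)) (A : EuclideanSpace ℝ (Fin 3) →L[ℝ] EuclideanSpace ℝ (Fin 3)) (θ : ℝ), (∀ x, inner ℝ (A x) x = 0) → a ∉ Set.range A → θ ≤ 0 → (∀ t < θ, ∀ x, fderiv ℝ (u t) x (a + A x) - A (u t x) = 0) → ∀ t < θ, ∀ x, u t x = 0

/-- `HelicalOrTranslationIsPeriodic → PeriodicEndCollapse → LineInvariantEndLiouville →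
HelicalEndLiouville` (the route decl, verbatim), pure logic. -/
theorem helicalEndLiouville_of_collapse (hH : HelicalOrTranslationIsPeriodic)
    (hP : PeriodicEndCollapse) (hL : LineInvariantEndLiouville) :
    HelicalEndLiouvilleVerbatim := by
  intro C u hu a A θ hAs hr hθ hsym t ht x
  obtain ⟨L, hL0, hper⟩ := hH C u hu a A θ hAs hr hθ hsym
  exact hL C u hu L θ hL0 hθ (hP C u hu L θ hθ hper) t ht x

/-- Card 2 concludes the crux as well (pure logic):
`HelicalOrTranslationIsPeriodic → PeriodicBackwardAmplitudeZero → KatoGapFromMinusInfinity → crux`. -/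
theorem helicalEndLiouville_of_blowDown (hH : HelicalOrTranslationIsPeriodic)
    (hA : PeriodicBackwardAmplitudeZero) (hK : KatoGapFromMinusInfinity) :
    HelicalEndLiouvilleVerbatim := by
  intro C u hu a A θ hAs hr hθ hsym t ht x
  obtain ⟨L, hL0, hper⟩ := hH C u hu a A θ hAs hr hθ hsym
  exact periodicEndLiouville_of_blowDown hA hK C u hu L θ hL0 hθ hper t ht x

/-- The far-past form plus forward stepping is how `PeriodicEndCollapse` is meant to be proved; the
converse bookkeeping `PeriodicEndCollapse → PeriodicFarPastCollapse` is trivial (any `κ > 0`). -/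
theorem periodicFarPastCollapse_of_periodicEndCollapse (h : PeriodicEndCollapse) :
    PeriodicFarPastCollapse := by
  refine ⟨1, one_pos, ?_⟩
  intro C u hu L θ hθ hper t ht _ x s
  exact h C u hu L θ hθ hper t ht x s


/-! ## Card 2, v2 (gen-2 sharpening, 2026-08-16): the STABILITY form of the compactness lever

Period-free first lemma `QuantitativeLineLiouville` — stability, inside the compact class `A_C`, of
the PROVED line-invariant leaf (`KNSS2009_typeI_rate_liouville_holds`; on the smooth class:
`Theorems.typeIAncientMild_eq_zero_of_planarInvariant`) — fed by the scale-invariant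
equicontinuity of `A_C` (an `L`-periodic element has line-oscillation `≤ ‖L‖`-increments, which are
`o((−t)^{-1/2})` deep in the past) and CLOSED by the PROVED small-constant theorem
`Theorems.exists_typeIAncientMild_eq_zero_of_small` plus forward uniqueness
(`BackwardEndVanishing`, route support item stmt-NavierStokesRegularity-14064). Compared with v1
(`PeriodicBackwardAmplitudeZero` + `KatoGapFromMinusInfinity` above): no blow-down along the orbit of
one solution, no near-maximiser selection at `tₙ → −∞`, no `limsup` bookkeeping, no symmetry
upgrade through shrinking periods, and no Kato-gap stub — the glue `periodicLiouville_of_stability`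
USES the small-constant theorem (kernel-checked below). -/

/-- **Scale-invariant equicontinuity of `A_C`** (S–M): for every `C` and `η > 0` there is `r > 0`
such that every `u ∈ A_C` satisfies `√(−t)‖u(t,x+h) − u(t,x)‖ ≤ η` whenever `‖h‖ ≤ r√(−t)`.
Source: the tree's uniform `1/4`-Hölder modulus `exists_holder_quarter_of_oseenMild`
(OseenMildHolder.lean: window `[a,b]`, bound `m`, `‖u t' x' − u t x‖ ≤ K₀(m+m²)·max(|t'−t|,‖x'−x‖)^{1/4}`
on `[a+1,b]`) applied to the unit-time rescaling `λu(λ²s, λy)`, `λ = √(−t)`, on the window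
`s ∈ [−2,−1]` where the field is bounded by `C` (scaling + translation covariance of the Oseen class,
`heatExtension_comp_smul`, `heatExtension_comp_add_left`, `oseenDuhamel_comp_add_right`):
`√(−t)‖u(t,x+h) − u(t,x)‖ ≤ K₀(C+C²)(‖h‖/√(−t))^{1/4}`, so `r = (η/(K₀(C+C²)))⁴` works. -/
def ScaleInvariantEquicontinuity : Prop :=
  ∀ (C η : ℝ), 0 < η → ∃ r : ℝ, 0 < r ∧ ∀ (u : ℝ → E3 → E3), IsTypeIAncientMild C u →
    ∀ t < 0, ∀ (x h : E3), ‖h‖ ≤ r * Real.sqrt (-t) →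
      Real.sqrt (-t) * ‖u t (x + h) - u t x‖ ≤ η

/-- **FIRST LEMMA of card 2 v2 — Quantitative line-Liouville (stability of the 2.5-D leaf)** (M):
for every `C` and `ε > 0` there is `δ > 0` such that an element of `A_C` whose SCALE-INVARIANT
oscillation along the lines `x + ℝL` is at most `δ` at every time (`√(−t)‖u(t,x+σL) − u(t,x)‖ ≤ δ`
for all `t < 0`, `x`, `σ ∈ ℝ`) has scale-invariant amplitude at most `ε` at every time. `δ` depends
on `C, ε` only (the hypothesis is invariant under `L ↦ cL` and under the symmetries of `A_C`).
Proof plan (compactness–contradiction, NO blow-down along an orbit): if not, there are `δₙ → 0`,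
`uₙ ∈ A_C`, unit `Lₙ → L_∞` and `(tₙ, xₙ)` with `√(−tₙ)‖uₙ(tₙ,xₙ)‖ > ε`; normalise by the symmetry group
of the CLASS — `vₙ(s,y) = λₙuₙ(λₙ²s, xₙ + λₙy)`, `λₙ = √(−tₙ)` (`vₙ ∈ A_C`, `‖vₙ(−1,0)‖ > ε`, hypothesis
unchanged) —, extract with `ACSequentialCompactness` (above; the tree's Lemma-6.1 toolkit
`exists_holder_quarter_of_oseenMild` + `HolderExtraction` + `OseenDuhamelLimits`) a continuous,
weakly div-free, Oseen-mild limit `W` with `√(−s)‖W‖ ≤ C` and `‖W(−1,0)‖ ≥ ε`; the hypothesis passes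
to the POINTWISE limit as exact invariance `W(s, y+σL_∞) = W(s,y)` (difference `≤ δₙ/√(−s) → 0`; no
equi-Hölder needed for this step); rotate `L_∞ ↦ e₂` (`RotationCovariance`) and shift `W(·−½)` to
make it bounded: `KNSS2009_typeI_rate_liouville_holds` gives `W ≡ 0` on `s < −½`, contradicting
`‖W(−1,0)‖ ≥ ε`. -/
def QuantitativeLineLiouville : Prop :=
  ∀ (C ε : ℝ), 0 < ε → ∃ δ : ℝ, 0 < δ ∧ ∀ (u : ℝ → E3 → E3), IsTypeIAncientMild C u →
    ∀ L : E3, L ≠ 0 →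
      (∀ t < 0, ∀ (x : E3) (σ : ℝ), Real.sqrt (-t) * ‖u t (x + σ • L) - u t x‖ ≤ δ) →
        ∀ t < 0, ∀ x, Real.sqrt (-t) * ‖u t x‖ ≤ ε

/-- **Rotation covariance of the class** (S; the one ingredient the standing disprover names for
the general translation direction — evidence note on the item, Positive.lean: "general translation
direction needs rotation covariance of the Oseen class"): conjugating by a linear isometry preserves
`A_C` (`heatExtension_comp_linearIsometryEquiv`, AxisymmetricHeatFlow.lean:57, and
`K(σ, Rz)[Ra, Rb] = R·K(σ, z)[a, b]` read off the Gaussian-weight formula of `oseenKernel`). -/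
def RotationCovariance : Prop :=
  ∀ (C : ℝ) (u : ℝ → E3 → E3), IsTypeIAncientMild C u → ∀ R : E3 ≃ₗᵢ[ℝ] E3,
    IsTypeIAncientMild C (fun t x => R.symm (u t (R x)))

/-- VERBATIM copy of the route's support item `Theses.SymmetryModuliCount.BackwardEndVanishing`
(stmt-NavierStokesRegularity-14064, S–M, hypothesis of the route's `closes`): vanishing on a backward
end propagates forward (forward uniqueness of bounded Oseen-mild solutions). Restated because the
farm's build of the route module may predate rev 5. -/
def BackwardEndVanishingVerbatim : Prop :=
  ∀ (C : ℝ) (u : ℝ → EuclideanSpace ℝ (Fin 3) → EuclideanSpace ℝ (Fin 3)), Literature.Analysis.FluidPDE.IsTypeIAncientMild C u → ∀ θ : ℝ, θ ≤ 0 → (∀ t < θ, ∀ x, u t x = 0) → ∀ t < 0, ∀ x, u t x = 0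

/-- One-step periodicity integrates to integer periodicity. [folklore] -/
theorem apply_add_intCast_smul_of_periodic {w : E3 → E3} {L : E3} (h : ∀ x, w (x + L) = w x)
    (x : E3) (n : ℤ) : w (x + (n : ℝ) • L) = w x := by
  induction n using Int.induction_on generalizing x with
  | zero => simp
  | succ i ih =>
      have e : ((((i : ℕ) : ℤ) + 1 : ℤ) : ℝ) = ((i : ℕ) : ℝ) + 1 := by push_cast; ring
      rw [e, add_smul, one_smul, ← add_assoc, h]
      have := ih x
      push_cast at this
      exact this
  | pred i ih =>
      have e : (((-((i : ℕ) : ℤ)) - 1 : ℤ) : ℝ) = -((i : ℕ) : ℝ) - 1 := by push_cast; ring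
      have key := h (x + (-((i : ℕ) : ℝ) - 1) • L)
      have e2 : x + (-((i : ℕ) : ℝ) - 1) • L + L = x + (-((i : ℕ) : ℝ)) • L := by
        simp only [sub_smul, one_smul, neg_smul]
        abel
      rw [e, ← key, e2]
      have := ih x
      push_cast at this
      exact this

/-- A point of the line `x + ℝL` is a lattice translate of a point of the segment `x + [0,1)L`.
[folklore] -/
theorem exists_rep_of_periodic {w : E3 → E3} {L : E3} (h : ∀ x, w (x + L) = w x) (x : E3) (σ : ℝ) :
    ∃ h' : E3, ‖h'‖ ≤ ‖L‖ ∧ w (x + σ • L) = w (x + h') := by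
  refine ⟨Int.fract σ • L, ?_, ?_⟩
  · rw [norm_smul, Real.norm_eq_abs, abs_of_nonneg (Int.fract_nonneg σ)]
    exact mul_le_of_le_one_left (norm_nonneg _) (Int.fract_lt_one σ).le
  · have e : x + σ • L = (x + Int.fract σ • L) + ((⌊σ⌋ : ℤ) : ℝ) • L := by
      rw [add_assoc, ← add_smul, Int.fract_add_floor]
    rw [e, apply_add_intCast_smul_of_periodic h]

/-- **GLUE of card 2 v2 (kernel-checked): periodic end-Liouville from the stability lemma.**
`ScaleInvariantEquicontinuity → QuantitativeLineLiouville → BackwardEndVanishing →` (every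
`L`-periodic-on-an-end element of `A_C` vanishes on that end), USING the proved tree theorem
`Theorems.exists_typeIAncientMild_eq_zero_of_small`. Bookkeeping: shift to the end
(`w = u(· + θ) ∈ A_C`, `comp_sub_right`), shift deep into the past (`v = w(· − T)`,
`T = (‖L‖/r)² + 1` with `r = r(C, δ(C, ε₀))`) so that the period fits under the equicontinuity
scale `r√(T − t)` at every `t < 0`; the line-oscillation of `v` is then `≤ δ`, the stability lemma
makes `v ∈ A_{ε₀}`, the small-constant theorem kills `v`, i.e. `w ≡ 0` on `t < −T`, and forward
uniqueness carries it to `t < 0`, i.e. `u ≡ 0` on `t < θ`. -/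
theorem periodicEndLiouville_of_stability (hE : ScaleInvariantEquicontinuity)
    (hQ : QuantitativeLineLiouville) (hB : BackwardEndVanishingVerbatim) :
    ∀ (C : ℝ) (u : ℝ → E3 → E3), IsTypeIAncientMild C u → ∀ (L : E3) (θ : ℝ), L ≠ 0 → θ ≤ 0 →
      (∀ t < θ, ∀ x, u t (x + L) = u t x) → ∀ t < θ, ∀ x, u t x = 0 := by
  intro C u hu L θ hL hθ hper
  obtain ⟨ε, hε, hsmall⟩ :=
    Summit.NavierStokesRegularity.NavierStokesRegularity.Theorems.exists_typeIAncientMild_eq_zero_of_small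
  obtain ⟨δ, hδ, hQ'⟩ := hQ C ε hε
  obtain ⟨r, hr, hE'⟩ := hE C δ hδ
  -- shift to the end: `w t = u (t + θ)`
  set w : ℝ → E3 → E3 := fun t => u (t - (-θ)) with hw
  have hwA : IsTypeIAncientMild C w := hu.comp_sub_right (by linarith)
  have hwper : ∀ t < 0, ∀ x, w t (x + L) = w t x := fun t ht x =>
    hper (t - (-θ)) (by linarith) x
  -- shift deep into the past: `v t = w (t - T)` with `‖L‖ ≤ r √T`
  set T : ℝ := (‖L‖ / r) ^ 2 + 1 with hT
  have hT0 : 0 < T := by positivity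
  have hLT : ‖L‖ ≤ r * Real.sqrt T := by
    have h1 : ‖L‖ / r ≤ Real.sqrt T := by
      calc ‖L‖ / r ≤ |‖L‖ / r| := le_abs_self _
        _ = Real.sqrt ((‖L‖ / r) ^ 2) := (Real.sqrt_sq_eq_abs _).symm
        _ ≤ Real.sqrt ((‖L‖ / r) ^ 2 + 1) := Real.sqrt_le_sqrt (by linarith)
    have := (div_le_iff₀ hr).1 h1
    linarith [mul_comm (Real.sqrt T) r]
  set v : ℝ → E3 → E3 := fun t => w (t - T) with hv
  have hvA : IsTypeIAncientMild C v := hwA.comp_sub_right hT0.le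
  -- the hypothesis of the stability lemma for `v`
  have hosc : ∀ t < 0, ∀ (x : E3) (σ : ℝ), Real.sqrt (-t) * ‖v t (x + σ • L) - v t x‖ ≤ δ := by
    intro t ht x σ
    have htT : t - T < 0 := by linarith
    obtain ⟨h', hh', hrep⟩ := exists_rep_of_periodic (hwper (t - T) htT) x σ
    show Real.sqrt (-t) * ‖w (t - T) (x + σ • L) - w (t - T) x‖ ≤ δ
    rw [hrep]
    have hfit : ‖h'‖ ≤ r * Real.sqrt (-(t - T)) :=
      calc ‖h'‖ ≤ ‖L‖ := hh'
        _ ≤ r * Real.sqrt T := hLT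
        _ ≤ r * Real.sqrt (-(t - T)) := by gcongr; linarith
    have key := hE' w hwA (t - T) htT x h' hfit
    have hsq : Real.sqrt (-t) ≤ Real.sqrt (-(t - T)) := Real.sqrt_le_sqrt (by linarith)
    calc Real.sqrt (-t) * ‖w (t - T) (x + h') - w (t - T) x‖
        ≤ Real.sqrt (-(t - T)) * ‖w (t - T) (x + h') - w (t - T) x‖ := by gcongr
      _ ≤ δ := key
  have hsmallv : ∀ t < 0, ∀ x, Real.sqrt (-t) * ‖v t x‖ ≤ ε := hQ' v hvA L hL hosc
  -- hence `v ∈ A_ε`, and the small-constant theorem kills it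
  have hvε : IsTypeIAncientMild ε v := by
    refine ⟨hvA.1, hvA.2.1, hvA.2.2.1, fun t ht x => ?_⟩
    have hsq : 0 < Real.sqrt (-t) := Real.sqrt_pos.2 (by linarith)
    rw [le_div_iff₀ hsq, mul_comm]
    exact hsmallv t ht x
  have hv0 : ∀ t < 0, ∀ x, v t x = 0 := hsmall ε v hvε le_rfl
  -- `w` vanishes on the end `t < -T`, hence everywhere by forward uniqueness
  have hw0 : ∀ t < -T, ∀ x, w t x = 0 := by
    intro t ht x
    have := hv0 (t + T) (by linarith) x
    simpa [hv] using this
  have hwall : ∀ t < 0, ∀ x, w t x = 0 := hB C w hwA (-T) (by linarith) hw0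
  intro t ht x
  have := hwall (t - θ) (by linarith) x
  simpa [hw] using this

/-- Card 2 v2 concludes the crux (kernel-checked):
`HelicalOrTranslationIsPeriodic → ScaleInvariantEquicontinuity → QuantitativeLineLiouville →
BackwardEndVanishing → HelicalEndLiouville` (route decl, verbatim). -/
theorem helicalEndLiouville_of_stability (hH : HelicalOrTranslationIsPeriodic)
    (hE : ScaleInvariantEquicontinuity) (hQ : QuantitativeLineLiouville)
    (hB : BackwardEndVanishingVerbatim) : HelicalEndLiouvilleVerbatim := by
  intro C u hu a A θ hAs hr hθ hsym t ht x
  obtain ⟨L, hL0, hper⟩ := hH C u hu a A θ hAs hr hθ hsym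
  exact periodicEndLiouville_of_stability hE hQ hB C u hu L θ hL0 hθ hper t ht x

/-- Sanity link between the two forms of card 2: the stability lemma implies v1's amplitude
statement `PeriodicBackwardAmplitudeZero` given equicontinuity (same bookkeeping as the glue, with
`ε` free instead of `ε₀`). Recorded as a statement; the glue above is what the line uses. -/
def StabilityImpliesAmplitudeZero : Prop :=
  ScaleInvariantEquicontinuity → QuantitativeLineLiouville → PeriodicBackwardAmplitudeZero

end Summit.NavierStokesRegularity.NavierStokesRegularity.Cruxes.HelicalEndLiouville.Ideator3

end
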